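import Literature.MathematicalPhysics.QuantumFieldTheory.OSRegularisedDensity
import HarnessLib

/-!
# Bounds for the descendants of the base kernel under the binary splitting (towards OS II Thm. 4.1 (4.5))

Topic `Literature/MathematicalPhysics/QuantumFieldTheory`; support file for the temperedness
estimate (4.5) of Osterwalder–Schrader II, Thm. 4.1. The explicit bound of the analytic
deconvolution lemma (`Literature.Analysis.Complex.deconvBound`, used in
`OSRegularisedDensityWindow.exists_holomorphic_density_skelDist_explicit`) is a weighted sum over the
**descendants** `descend (admSplit ê hli) J σ a₀` of the base index `a₀ = (c₀, κ₀, …, κ_{k+1})`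
under the binary coordinate splitting `skelSplit` (one profile multiplied by a dual coordinate
`⟪·, dualDir ν⟫`, the scalar kept, negated or replaced by `0`). This file bounds them generically:

* `norm_fst_admSplit_le`, `profProd_admSplit_le` — one splitting step does not increase the scalar
  and multiplies the product of the profile norms `profProd M` by at most `D`, whenever
  `|⟪·, dualDir ν⟫ φ|_M ≤ D |φ|_M` for all admissible profiles `φ` (hypothesis `hD`, supplied by
  `OSBumpProfileBounds.schwartzNorm_coordMul_le`) and `D ≥ 1`;
* `descend_admSplit_le` — after `n` steps: `‖scalar‖ ≤ ‖c₀‖`, `profProd M ≤ Dⁿ profProd M κ⃗`;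
* `descendSum_admSplit_le`, `deconvBound_admSplit_le` — for constants of the form
  `C a ≤ A ‖a.1‖ profProd M a.2` (the shape of `regCW`),
  `descendSum n ≤ ((k+2) d · 2)ⁿ A ‖c₀‖ Dⁿ profProd M κ⃗` and the resulting closed form `descBound`
  for `deconvBound`.

## References

* K. Osterwalder, R. Schrader, *Axioms for Euclidean Green's functions II*, Comm. Math. Phys.
  42 (1975) 281–305, Thm. 4.1 (4.5), Ch. VI.1. [OsterwalderSchraderCMP1975]
-/

noncomputable section

open MeasureTheory Set Filter Metric
open _root_.Topology
open scoped InnerProductSpace RealInnerProductSpace SchwartzMap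

namespace Literature.MathematicalPhysics.QuantumFieldTheory

open Literature.MathematicalPhysics.QuantumLattice (schwartzNorm)
open Literature.Analysis.Distribution
open Literature.Analysis.Complex

variable {d : ℕ} {k : ℕ} (ê : Fin d → EuclideanSpace ℝ (Fin d)) (hli : LinearIndependent ℝ ê) {r₀ : ℝ}

/-! ### One splitting step -/

/-- Replacing one profile multiplies `profProd` by the ratio of the norms. [folklore] -/
theorem profProd_update_le (M : ℕ) (φ : Fin (k + 2) → 𝓢(EuclideanSpace ℝ (Fin d), ℂ)) (i : Fin (k + 2))
    (ψ : 𝓢(EuclideanSpace ℝ (Fin d), ℂ)) {D : ℝ} (hψ : schwartzNorm M ψ ≤ D * schwartzNorm M (φ i)) :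
    profProd M (Function.update φ i ψ) ≤ D * profProd M φ := by
  unfold profProd
  have h1 : (fun J => schwartzNorm M (Function.update φ i ψ J)) =
      Function.update (fun J => schwartzNorm M (φ J)) i (schwartzNorm M ψ) := by
    funext J
    by_cases hJ : J = i
    · subst hJ; simp
    · simp [Function.update_of_ne hJ]
  rw [show ∏ J, schwartzNorm M (Function.update φ i ψ J) = ∏ J, (fun J => schwartzNorm M (Function.update φ i ψ J)) J from rfl,
    h1, Finset.prod_update_of_mem (Finset.mem_univ i), Finset.sdiff_singleton_eq_erase,
    ← Finset.mul_prod_erase Finset.univ (fun J => schwartzNorm M (φ J)) (Finset.mem_univ i), ← mul_assoc]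
  exact mul_le_mul_of_nonneg_right hψ (Finset.prod_nonneg fun J _ => QuantumLattice.schwartzNorm_nonneg _ _)

/-- **The scalar of a split index**: both components of `admSplit p a` have scalar of norm at most
`‖a.1‖`. [folklore] -/
theorem norm_fst_admSplit_le (p : Fin (k + 2) × Fin d) (a : AdmIdx k d r₀) :
    ‖(admSplit ê hli p a).1.1.1‖ ≤ ‖a.1.1‖ ∧ ‖(admSplit ê hli p a).2.1.1‖ ≤ ‖a.1.1‖ := by
  obtain ⟨i, ν⟩ := p
  constructor
  · simp [admSplit, skelSplit]
  · simp only [admSplit, skelSplit]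
    refine Fin.cases ?_ (fun j => ?_) i
    · simp
    · simp

/-- **The profiles of a split index**: if `|⟪·, dualDir ν⟫ φ|_M ≤ D |φ|_M` for all profiles
supported in `B̄(0, r₀)` and `D ≥ 1`, then both components of `admSplit p a` have
`profProd M ≤ D · profProd M a`. [folklore] -/
theorem profProd_admSplit_le (M : ℕ) {D : ℝ} (hD1 : 1 ≤ D)
    (hD : ∀ (ν : Fin d) (φ : 𝓢(EuclideanSpace ℝ (Fin d), ℂ)),
      tsupport (φ : EuclideanSpace ℝ (Fin d) → ℂ) ⊆ Metric.closedBall 0 r₀ →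
        schwartzNorm M (coordMul (dualDir ê hli ν) φ) ≤ D * schwartzNorm M φ)
    (p : Fin (k + 2) × Fin d) (a : AdmIdx k d r₀) :
    profProd M (admSplit ê hli p a).1.1.2 ≤ D * profProd M a.1.2 ∧
      profProd M (admSplit ê hli p a).2.1.2 ≤ D * profProd M a.1.2 := by
  obtain ⟨i, ν⟩ := p
  have hP0 : 0 ≤ profProd M a.1.2 := profProd_nonneg M _
  constructor
  · simp only [admSplit, skelSplit]
    exact profProd_update_le M a.1.2 i _ (hD ν _ (a.2 i))
  · simp only [admSplit, skelSplit]
    refine Fin.cases ?_ (fun j => ?_) i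
    · simp only [Fin.cases_zero]
      nlinarith
    · simp only [Fin.cases_succ]
      exact profProd_update_le M a.1.2 (Fin.castSucc j) _ (hD ν _ (a.2 (Fin.castSucc j)))

/-! ### Descendants -/

/-- **Descendants of depth `n`**: scalar of norm at most `‖a.1‖`, profile product at most `Dⁿ profProd M a`. [folklore] -/
theorem descend_admSplit_le (M : ℕ) {D : ℝ} (hD1 : 1 ≤ D)
    (hD : ∀ (ν : Fin d) (φ : 𝓢(EuclideanSpace ℝ (Fin d), ℂ)),
      tsupport (φ : EuclideanSpace ℝ (Fin d) → ℂ) ⊆ Metric.closedBall 0 r₀ →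
        schwartzNorm M (coordMul (dualDir ê hli ν) φ) ≤ D * schwartzNorm M φ)
    (a : AdmIdx k d r₀) :
    ∀ {n : ℕ} (J : Fin n → Fin (k + 2) × Fin d) (σ : Fin n → Bool),
      ‖(descend (admSplit ê hli) J σ a).1.1‖ ≤ ‖a.1.1‖ ∧
        profProd M (descend (admSplit ê hli) J σ a).1.2 ≤ D ^ n * profProd M a.1.2
  | 0, J, σ => by simp
  | n + 1, J, σ => by
    obtain ⟨hs, hp⟩ := descend_admSplit_le M hD1 hD a (Fin.tail J) (Fin.tail σ)
    have hstep_s := norm_fst_admSplit_le ê hli (J 0) (descend (admSplit ê hli) (Fin.tail J) (Fin.tail σ) a)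
    have hstep_p := profProd_admSplit_le ê hli M hD1 hD (J 0) (descend (admSplit ê hli) (Fin.tail J) (Fin.tail σ) a)
    have hD0 : 0 ≤ D := zero_le_one.trans hD1
    rw [descend]
    split_ifs with h0
    · exact ⟨hstep_s.1.trans hs, hstep_p.1.trans (by rw [pow_succ]; nlinarith [pow_nonneg hD0 n])⟩
    · exact ⟨hstep_s.2.trans hs, hstep_p.2.trans (by rw [pow_succ]; nlinarith [pow_nonneg hD0 n])⟩

/-! ### The sums over descendants and the explicit deconvolution bound -/

/-- **The sum over the descendants of depth `n`** for constants of the form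
`C a ≤ A ‖a.1‖ profProd M a.2` (`A ≥ 0`): `descendSum n ≤ ((k+2) d · 2)ⁿ · A ‖a₀.1‖ Dⁿ profProd M a₀.2`. [folklore] -/
theorem descendSum_admSplit_le (M : ℕ) {D : ℝ} (hD1 : 1 ≤ D)
    (hD : ∀ (ν : Fin d) (φ : 𝓢(EuclideanSpace ℝ (Fin d), ℂ)),
      tsupport (φ : EuclideanSpace ℝ (Fin d) → ℂ) ⊆ Metric.closedBall 0 r₀ →
        schwartzNorm M (coordMul (dualDir ê hli ν) φ) ≤ D * schwartzNorm M φ)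
    {C : AdmIdx k d r₀ → ℝ} {A : ℝ} (hA : 0 ≤ A) (hC : ∀ a : AdmIdx k d r₀, C a ≤ A * ‖a.1.1‖ * profProd M a.1.2)
    (a : AdmIdx k d r₀) (n : ℕ) :
    descendSum (admSplit ê hli) C a n ≤ (((k + 2 : ℝ) * d) ^ n * 2 ^ n) * (A * ‖a.1.1‖ * (D ^ n * profProd M a.1.2)) := by
  unfold descendSum
  have hterm : ∀ (J : Fin n → Fin (k + 2) × Fin d) (σ : Fin n → Bool),
      C (descend (admSplit ê hli) J σ a) ≤ A * ‖a.1.1‖ * (D ^ n * profProd M a.1.2) := fun J σ => by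
    obtain ⟨hs, hp⟩ := descend_admSplit_le ê hli M hD1 hD a J σ
    refine (hC _).trans ?_
    have h1 : 0 ≤ profProd M (descend (admSplit ê hli) J σ a).1.2 := profProd_nonneg M _
    calc A * ‖(descend (admSplit ê hli) J σ a).1.1‖ * profProd M (descend (admSplit ê hli) J σ a).1.2
        ≤ A * ‖a.1.1‖ * profProd M (descend (admSplit ê hli) J σ a).1.2 := by gcongr
      _ ≤ A * ‖a.1.1‖ * (D ^ n * profProd M a.1.2) := by gcongr
  calc ∑ J : Fin n → Fin (k + 2) × Fin d, ∑ σ : Fin n → Bool, C (descend (admSplit ê hli) J σ a)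
      ≤ ∑ _J : Fin n → Fin (k + 2) × Fin d, ∑ _σ : Fin n → Bool, A * ‖a.1.1‖ * (D ^ n * profProd M a.1.2) :=
        Finset.sum_le_sum fun J _ => Finset.sum_le_sum fun σ _ => hterm J σ
    _ = (((k + 2 : ℝ) * d) ^ n * 2 ^ n) * (A * ‖a.1.1‖ * (D ^ n * profProd M a.1.2)) := by
        rw [Finset.sum_const, Finset.sum_const, Finset.card_univ, Finset.card_univ, Fintype.card_fun,
          Fintype.card_fun, Fintype.card_bool, Fintype.card_fin, Fintype.card_prod, Fintype.card_fin,
          Fintype.card_fin, nsmul_eq_mul, nsmul_eq_mul]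
        push_cast
        ring

/-- **The closed form of the deconvolution bound** for constants of the shape `A ‖a.1‖ profProd M a.2`:
with `q = 2 (k+2) d D · 2(p+2)/r`,
`descBound = A ‖c₀‖ profProd M κ⃗ · (∑_{n ≤ p} qⁿ/n! + q^{p+1}/p!)`. [folklore] -/
def descBound (k d : ℕ) (D A c P : ℝ) (p : ℕ) (r : ℝ) : ℝ :=
  A * c * P * (∑ n ∈ Finset.range (p + 1), ((k + 2 : ℝ) * d) ^ n * 2 ^ n * D ^ n * (2 * (p + 2) / r) ^ n / (n.factorial : ℝ) +
    ((k + 2 : ℝ) * d) ^ (p + 1) * 2 ^ (p + 1) * D ^ (p + 1) * (2 * (p + 2) / r) ^ (p + 1) / (p.factorial : ℝ))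

/-- **The explicit deconvolution bound through the base index**:
`deconvBound (admSplit ê hli) C a₀ p r ≤ descBound k d D A ‖a₀.1‖ (profProd M a₀.2) p r`. [folklore] -/
theorem deconvBound_admSplit_le (M : ℕ) {D : ℝ} (hD1 : 1 ≤ D)
    (hD : ∀ (ν : Fin d) (φ : 𝓢(EuclideanSpace ℝ (Fin d), ℂ)),
      tsupport (φ : EuclideanSpace ℝ (Fin d) → ℂ) ⊆ Metric.closedBall 0 r₀ →
        schwartzNorm M (coordMul (dualDir ê hli ν) φ) ≤ D * schwartzNorm M φ)
    {C : AdmIdx k d r₀ → ℝ} {A : ℝ} (hA : 0 ≤ A) (hC : ∀ a : AdmIdx k d r₀, C a ≤ A * ‖a.1.1‖ * profProd M a.1.2)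
    (a : AdmIdx k d r₀) (p : ℕ) {r : ℝ} (hr : 0 < r) :
    deconvBound (admSplit ê hli) C a p r ≤ descBound k d D A ‖a.1.1‖ (profProd M a.1.2) p r := by
  have hs : ∀ n, descendSum (admSplit ê hli) C a n ≤ (((k + 2 : ℝ) * d) ^ n * 2 ^ n) * (A * ‖a.1.1‖ * (D ^ n * profProd M a.1.2)) :=
    fun n => descendSum_admSplit_le ê hli M hD1 hD hA hC a n
  unfold deconvBound descBound
  have hmain : ∀ n : ℕ, (2 * ((p : ℝ) + 2) / r) ^ n / (n.factorial : ℝ) * descendSum (admSplit ê hli) C a n ≤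
      A * ‖a.1.1‖ * profProd M a.1.2 *
        (((k + 2 : ℝ) * d) ^ n * 2 ^ n * D ^ n * (2 * (p + 2) / r) ^ n / (n.factorial : ℝ)) := fun n => by
    calc (2 * ((p : ℝ) + 2) / r) ^ n / (n.factorial : ℝ) * descendSum (admSplit ê hli) C a n
        ≤ (2 * ((p : ℝ) + 2) / r) ^ n / (n.factorial : ℝ) *
            ((((k + 2 : ℝ) * d) ^ n * 2 ^ n) * (A * ‖a.1.1‖ * (D ^ n * profProd M a.1.2))) :=
          mul_le_mul_of_nonneg_left (hs n) (by positivity)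
      _ = A * ‖a.1.1‖ * profProd M a.1.2 *
            (((k + 2 : ℝ) * d) ^ n * 2 ^ n * D ^ n * (2 * (p + 2) / r) ^ n / (n.factorial : ℝ)) := by ring
  calc ∑ n ∈ Finset.range (p + 1), (2 * ((p : ℝ) + 2) / r) ^ n / (n.factorial : ℝ) * descendSum (admSplit ê hli) C a n +
        (2 * ((p : ℝ) + 2) / r) ^ (p + 1) / (p.factorial : ℝ) * descendSum (admSplit ê hli) C a (p + 1)
      ≤ ∑ n ∈ Finset.range (p + 1), A * ‖a.1.1‖ * profProd M a.1.2 *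
          (((k + 2 : ℝ) * d) ^ n * 2 ^ n * D ^ n * (2 * (p + 2) / r) ^ n / (n.factorial : ℝ)) +
        A * ‖a.1.1‖ * profProd M a.1.2 *
          (((k + 2 : ℝ) * d) ^ (p + 1) * 2 ^ (p + 1) * D ^ (p + 1) * (2 * (p + 2) / r) ^ (p + 1) / (p.factorial : ℝ)) := by
        refine add_le_add (Finset.sum_le_sum fun n _ => hmain n) ?_
        calc (2 * ((p : ℝ) + 2) / r) ^ (p + 1) / (p.factorial : ℝ) * descendSum (admSplit ê hli) C a (p + 1)
            ≤ (2 * ((p : ℝ) + 2) / r) ^ (p + 1) / (p.factorial : ℝ) *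
                ((((k + 2 : ℝ) * d) ^ (p + 1) * 2 ^ (p + 1)) * (A * ‖a.1.1‖ * (D ^ (p + 1) * profProd M a.1.2))) :=
              mul_le_mul_of_nonneg_left (hs (p + 1)) (by positivity)
          _ = A * ‖a.1.1‖ * profProd M a.1.2 *
              (((k + 2 : ℝ) * d) ^ (p + 1) * 2 ^ (p + 1) * D ^ (p + 1) * (2 * (p + 2) / r) ^ (p + 1) / (p.factorial : ℝ)) := by
              ring
    _ = _ := by rw [← Finset.mul_sum]; ring

end Literature.MathematicalPhysics.QuantumFieldTheory
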